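import Summits.ValiantsHypothesis.ValiantsHypothesis.Theorems.KPlusLogSqLawStaticPathSignedTipCount
import Summits.ValiantsHypothesis.ValiantsHypothesis.Theorems.KPlusLogSqLawStaticPathLowTipsBetween
import Summits.ValiantsHypothesis.ValiantsHypothesis.Theorems.KPlusLogSqLawStaticPathMixedEvents

/-!
# Route «KPlusLogSqLaw» — parametric max-weight independent set on a path: THEOREM T′ — for every slope threshold `λ`, at most `3n` odd–odd hops straddle `λ`

HONEST FRAMING.  Helper toward the crux `WeakLifting` (item `stmt-ValiantsHypothesis-19561`, route `KPlusLogSqLaw`, cell `pub-symmetroid`,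
seat val-sym-lift-p4 g21, 2026-08-29) on the line of its witness-plan stub `stub_tridiagonalSectorB` (tropical twin of the STATIC tridiagonal
sector = parametric maximum-weight independent set on a path).  THEOREM T′ of the lineage (THEOREM-T.md §4, val-sym-lift-p4 g14, «the cut
lemma; same method, every direction») in the kernel: for `n + 1` lines in general position (pairwise distinct slopes, no three concurrent) and a
slope threshold `λ` different from all slopes, the EVENTS (pairs with (M), (L), (R), as in THEOREM T `…StaticPathMixedEvents.mixedEvents_card_le`)
formed by two ODD lines whose slopes STRADDLE `λ` — the vacancy HOPS of an odd vacancy across the slope `λ` — number at most `3n`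
(**`hopsOdd_straddle_card_le`**): by the signed counting lemma `…StaticPathSignedTipCount.signed_card_le_of_unique_tips` applied to the λ-low tips
(`…StaticPathLowTips.lowTip_unique`, `…StaticPathLowTipsBetween.lowTip_between`) they exceed the λ-low mixed events by at most `n`, and the
mixed events are at most `2n` (THEOREM T).  The even–even hops are symmetric (reflect `y ↦ -y` and shift indices) and are not treated here.
Statements about a labelled line arrangement; nothing here asserts anything about `WeakLifting`, `TropicalB`, `KPlusLogSqLaw`, the stub in its
window, `MatrixDescartes` (stmt-ValiantsHypothesis-18050) or `VP ≠ VNP`; whether ALL hops are `O(n)` (the ORDER QUESTION) stays open — T′ bounds,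
for each `λ`, only the hops crossing `λ`.
-/

set_option linter.dupNamespace false
set_option autoImplicit false

namespace Summit.ValiantsHypothesis.ValiantsHypothesis.Theorems.KPlusLogSqLaw

open Finset Classical

namespace StaticPathFold

noncomputable section

variable (a b : ℕ → ℝ)

/-- **THEOREM T′ (odd–odd hops across a slope threshold are at most `3n`).**  Lines `L a b 0, …, L a b n` with pairwise distinct slopes and no
third line through a crossing, `λ` different from every slope; the pairs `p < q ≤ n` of ODD lines with `a p < λ < a q` or `a q < λ < a p` that are
events — (M) every line strictly between is correct at their vertex, (L) an even maximal run of correct lines just left of `p`, (R) likewise right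
of `q` inside `0..n` — number at most `3 n`. [folklore] -/
theorem hopsOdd_straddle_card_le (n : ℕ) (lam : ℝ)
    (hslope : ∀ p q, p ≤ n → q ≤ n → p ≠ q → a p ≠ a q) (hlam : ∀ p, p ≤ n → a p ≠ lam)
    (hgp : ∀ p q t, p ≤ n → q ≤ n → t ≤ n → p ≠ q → t ≠ p → t ≠ q →
      L a b t ((b q - b p) / (a p - a q)) ≠ L a b p ((b q - b p) / (a p - a q))) :
    (((range (n + 1)) ×ˢ (range (n + 1))).filter (fun pq : ℕ × ℕ => pq.1 < pq.2 ∧ pq.2 ≤ n ∧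
        (¬ Even pq.1 ∧ ¬ Even pq.2 ∧ ((a pq.1 < lam ∧ lam < a pq.2) ∨ (a pq.2 < lam ∧ lam < a pq.1))) ∧
        (∀ t, pq.1 < t → t < pq.2 →
          0 < gap t (L a b pq.1 ((b pq.2 - b pq.1) / (a pq.1 - a pq.2))) (L a b t ((b pq.2 - b pq.1) / (a pq.1 - a pq.2)))) ∧
        (∃ r, Even r ∧ r ≤ pq.1 ∧
          (∀ t, pq.1 - r ≤ t → t < pq.1 →
            0 < gap t (L a b pq.1 ((b pq.2 - b pq.1) / (a pq.1 - a pq.2))) (L a b t ((b pq.2 - b pq.1) / (a pq.1 - a pq.2)))) ∧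
          (r = pq.1 ∨ ¬ 0 < gap (pq.1 - r - 1) (L a b pq.1 ((b pq.2 - b pq.1) / (a pq.1 - a pq.2)))
            (L a b (pq.1 - r - 1) ((b pq.2 - b pq.1) / (a pq.1 - a pq.2))))) ∧
        (∃ r, Even r ∧ pq.2 + r ≤ n ∧
          (∀ t, pq.2 < t → t ≤ pq.2 + r →
            0 < gap t (L a b pq.1 ((b pq.2 - b pq.1) / (a pq.1 - a pq.2))) (L a b t ((b pq.2 - b pq.1) / (a pq.1 - a pq.2)))) ∧
          (pq.2 + r = n ∨ ¬ 0 < gap (pq.2 + r + 1) (L a b pq.1 ((b pq.2 - b pq.1) / (a pq.1 - a pq.2)))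
            (L a b (pq.2 + r + 1) ((b pq.2 - b pq.1) / (a pq.1 - a pq.2))))))).card ≤ 3 * n := by
  -- the λ-type predicate and the correctness predicate
  set S : ℕ → ℕ → Prop := fun p q =>
    ((¬ Even p ∧ ¬ Even q ∧ ((a p < lam ∧ lam < a q) ∨ (a q < lam ∧ lam < a p))) ∨
     (Odd (p + q) ∧ (if Even p then a q < a p else a p < a q) ∧ lam < (if Even p then a q else a p)) ∨
     (Odd (p + q) ∧ (if Even p then a p < a q else a q < a p) ∧ (if Even p then a q else a p) < lam)) with hSdef
  have hS : ∀ p q, S p q ↔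
      ((¬ Even p ∧ ¬ Even q ∧ ((a p < lam ∧ lam < a q) ∨ (a q < lam ∧ lam < a p))) ∨
       (Odd (p + q) ∧ (if Even p then a q < a p else a p < a q) ∧ lam < (if Even p then a q else a p)) ∨
       (Odd (p + q) ∧ (if Even p then a p < a q else a q < a p) ∧ (if Even p then a q else a p) < lam)) := fun _ _ => Iff.rfl
  set G : ℕ → ℕ → ℕ → Prop := fun p q t =>
    0 < gap t (L a b p ((b q - b p) / (a p - a q))) (L a b t ((b q - b p) / (a p - a q))) with hGdef
  -- the signed count over λ-low tips
  have key := signed_card_le_of_unique_tips n G S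
    (fun i j p q p' q' h1 h2 h3 h4 h5 h6 h7 h8 h9 h10 =>
      lowTip_unique a b lam S hS i j p q p' q' h1 h2 h3 h4 h5 h6 h7 h8 h9 h10)
    (fun i j₁ j₂ j₃ h12 h23 h3n h1 h3 => lowTip_between a b lam S hS n hslope hlam hgp i j₁ j₂ j₃ h12 h23 h3n h1 h3)
  -- THEOREM T bounds the odd (mixed) part
  have hT := mixedEvents_card_le a b n hslope hgp
  -- compare the three sets
  set P : Finset (ℕ × ℕ) := (range (n + 1)) ×ˢ (range (n + 1)) with hP
  have hsub1 : P.filter (fun pq : ℕ × ℕ => pq.1 < pq.2 ∧ pq.2 ≤ n ∧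
        (¬ Even pq.1 ∧ ¬ Even pq.2 ∧ ((a pq.1 < lam ∧ lam < a pq.2) ∨ (a pq.2 < lam ∧ lam < a pq.1))) ∧
        (∀ t, pq.1 < t → t < pq.2 → G pq.1 pq.2 t) ∧
        (∃ r, Even r ∧ r ≤ pq.1 ∧ (∀ t, pq.1 - r ≤ t → t < pq.1 → G pq.1 pq.2 t) ∧ (r = pq.1 ∨ ¬ G pq.1 pq.2 (pq.1 - r - 1))) ∧
        (∃ r, Even r ∧ pq.2 + r ≤ n ∧ (∀ t, pq.2 < t → t ≤ pq.2 + r → G pq.1 pq.2 t) ∧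
          (pq.2 + r = n ∨ ¬ G pq.1 pq.2 (pq.2 + r + 1)))) ⊆
      P.filter (fun pq : ℕ × ℕ => pq.1 < pq.2 ∧ pq.2 ≤ n ∧ S pq.1 pq.2 ∧
        (∀ t, pq.1 < t → t < pq.2 → G pq.1 pq.2 t) ∧
        (∃ r, Even r ∧ r ≤ pq.1 ∧ (∀ t, pq.1 - r ≤ t → t < pq.1 → G pq.1 pq.2 t) ∧ (r = pq.1 ∨ ¬ G pq.1 pq.2 (pq.1 - r - 1))) ∧
        (∃ r, Even r ∧ pq.2 + r ≤ n ∧ (∀ t, pq.2 < t → t ≤ pq.2 + r → G pq.1 pq.2 t) ∧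
          (pq.2 + r = n ∨ ¬ G pq.1 pq.2 (pq.2 + r + 1))) ∧ Even (pq.1 + pq.2)) := by
    intro pq hpq
    rw [mem_filter] at hpq ⊢
    obtain ⟨hP', hlt, hqn, ⟨hpo, hqo, hstr⟩, hM, hL, hR⟩ := hpq
    refine ⟨hP', hlt, hqn, Or.inl ⟨hpo, hqo, hstr⟩, hM, hL, hR, ?_⟩
    rw [Nat.even_add]
    exact ⟨fun h => absurd h hpo, fun h => absurd h hqo⟩
  have hsub2 : P.filter (fun pq : ℕ × ℕ => pq.1 < pq.2 ∧ pq.2 ≤ n ∧ S pq.1 pq.2 ∧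
        (∀ t, pq.1 < t → t < pq.2 → G pq.1 pq.2 t) ∧
        (∃ r, Even r ∧ r ≤ pq.1 ∧ (∀ t, pq.1 - r ≤ t → t < pq.1 → G pq.1 pq.2 t) ∧ (r = pq.1 ∨ ¬ G pq.1 pq.2 (pq.1 - r - 1))) ∧
        (∃ r, Even r ∧ pq.2 + r ≤ n ∧ (∀ t, pq.2 < t → t ≤ pq.2 + r → G pq.1 pq.2 t) ∧
          (pq.2 + r = n ∨ ¬ G pq.1 pq.2 (pq.2 + r + 1))) ∧ Odd (pq.1 + pq.2)) ⊆
      P.filter (fun pq : ℕ × ℕ => pq.1 < pq.2 ∧ pq.2 ≤ n ∧ Odd (pq.1 + pq.2) ∧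
        (∀ t, pq.1 < t → t < pq.2 → G pq.1 pq.2 t) ∧
        (∃ r, Even r ∧ r ≤ pq.1 ∧ (∀ t, pq.1 - r ≤ t → t < pq.1 → G pq.1 pq.2 t) ∧ (r = pq.1 ∨ ¬ G pq.1 pq.2 (pq.1 - r - 1))) ∧
        (∃ r, Even r ∧ pq.2 + r ≤ n ∧ (∀ t, pq.2 < t → t ≤ pq.2 + r → G pq.1 pq.2 t) ∧
          (pq.2 + r = n ∨ ¬ G pq.1 pq.2 (pq.2 + r + 1)))) := by
    intro pq hpq
    rw [mem_filter] at hpq ⊢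
    obtain ⟨hP', hlt, hqn, -, hM, hL, hR, hodd⟩ := hpq
    exact ⟨hP', hlt, hqn, hodd, hM, hL, hR⟩
  have h1 := card_le_card hsub1
  have h2 := card_le_card hsub2
  simp only [hGdef] at h1 h2 key hT ⊢
  omega

end

end StaticPathFold

end Summit.ValiantsHypothesis.ValiantsHypothesis.Theorems.KPlusLogSqLaw
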